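/-
Copyright (c) 2026 the pub-hodgecm-mathlib formalisation cell (harness21).  Prover seat hodgecm-mathlib-LH4-p19 (g2), req620 Track A «(D-RAM) FOUR-FRAME» squad
(STAGE-1b, row (2) of the piece `f_{T₊}`, the (β₂) road (R-36) «PURE-CELL LEDGER»; β₂ sub-dealer LH4-p04 (g9) BETA2-BOARD v2 row (ROW-D♭), dealt by name; the digit map of the
diagonal cell: every lattice has a literal digit, and the affine label depends only on the digit), 2026-09-04.
-/
import Summits.HodgeConjecture.HodgeConjecture.Theorems.F0P3cDyRamDiagonalCellGeneratorIndependence  -- ★ (this seat, K5c): `coords_letters_of_gen`; brings ★ K3, ★ K2, Literature `normSign_*`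
import Summits.HodgeConjecture.HodgeConjecture.Theorems.F0P3cDyRamDiagonalCellFibreTransport        -- ★ (this seat, K5b): `hatw_div_hatw_eq_one_add`
import HarnessLib

/-!
# Crux `H413`, line LH4 «(D-RAM) FOUR-FRAME» — STAGE-1b, row (2), the (β₂) road (R-36), lane B, row (ROW-D♭), THE COUNT — «THE DIGIT MAP OF THE DIAGONAL CELL»: every lattice of
# `D` has a LITERAL digit (`ŵ(V)∕ŵ(x_ref)` is a `Θ`-norm), the literal and the affine label are constant on digit classes, and `V` has an `E`-side preimage

Cell `hodgecm-mathlib` (D-0151), FLOOR 0, crux item H413 = `stmt-HodgeConjecture-24833`, route of record `HCCMUnconditional`; squad F0∕P3c∕LH4; lane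
`--supports stmt-HodgeConjecture-24833 --as helper` (count-neutral; pays NO tier-0 row).  THEOREMS ONLY (no `def`, no instance, no notation, no `sorry`, default heartbeats);
★-only imports; states NO law; (β₂) stays a HYPOTHESIS.  DATUM-FREE letters: one field `K` with `ρ`, `Θ` (§1–§3) or the two-field frame `jE : E → M` (§4); the ramified data
`IsRamifiedQuadraticDatum` of ★ DEFS enter only §1 (M-side, for `Θ`) and §3 (E-side, for `σ`); `hFN` («doubly fixed units are `Θ`-norms») is a binder of §2 as in ★ p862758.

WHY (memo MECH-LDflat §2–§3; this seat's K5b ∕ K5c ∕ K6a).  The assembly of the (ROW-D♭) count fibres the populated part of `D = levelSet ρ Θ α ϖE h b b` over the digit system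
`R_d` by `Λ ↦ digit of V(x₀)`; it needs (i) that every digit so obtained is LITERAL — `ω_Θ(ŵ(jE V₀)∕c) = 1` with `c = ŵ(x_ref)` the `ŵ` of a reference generator — because
`ŵ(V(x₀))∕ŵ(x_ref) = N_Θ((x_ref∕x₀)∕z_T)` (`ŵ(x₀) = T·ŵ(V)`, `T = z_T Θ z_T` by `hFN`) and the literal is constant on digit classes (`ŵ(Y′)∕ŵ(Y) ≡ 1 (ϖ^{2d})` is a norm); (ii) that
the affine label `ω_σ(α₁ + γ₁V)` is constant on digit classes (★ `normSign_eq_of_near`); (iii) an `E`-side preimage of the doubly fixed `V`.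
* §1 `normSign_hatw_div_eq_of_near` — M-side: doubly fixed integers `Y, Y′` with `|Y′ − Y| ≤ |ϖ|^{2d}` have `ω_Θ(ŵ(Y′)∕c) = ω_Θ(ŵ(Y)∕c)`.
* §2 `exists_mul_map_eq_hatwV_div` — `ŵ(V(x₀))∕ŵ(x_ref)` is a `Θ`-norm for a generator `x₀` of a lattice of `D` and any `x_ref ≠ 0` (letter `hFN`).
* §3 `normSign_affineLabel_eq_of_near` — E-side: `σ`-fixed integers `V, V′` with `|V′ − V| ≤ |ϖ|^{2d}` have `ω_σ(α₁ + γ₁V′) = ω_σ(α₁ + γ₁V)` (`|α₁| = 1`, `|γ₁| < 1`).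
* §4 `exists_preimage_of_fixed` — a `ρ`-fixed, `Θ`-fixed integer of `M` is `jE` of a `σ`-fixed integer of `E`.
WHAT IS NOT CLAIMED: the assembly itself (K6c), the bridge to the canonical cone-ledger labels `q±`.
HONEST LABEL.  Count-neutral lattice bookkeeping; nothing printed is asserted; no census law is stated; `HC_CM` is proved only modulo the 7 printed citations (2 remaining named
inputs: hLiu418 = `stmt-HodgeConjecture-24832`, h413 = `stmt-HodgeConjecture-24833`) until rung 0 closes.
## References
* [Serre1979] J.-P. Serre, *Local Fields*, GTM 67 (1979): Ch. V §2 Prop. 3, Ch. V §3 Cor. 3 pp. 85–87, Ch. XV §2 (norm classes near `1`).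
* [Jacobowitz1962] R. Jacobowitz, *Hermitian forms over local fields*, Amer. J. Math. 84 (1962): §4 (dual lattices, gluing).
* [Kottwitz1986BaseChangeUnits] R. E. Kottwitz, *Base change for unit elements of Hecke algebras*, Compositio Math. 60 (1986): §1 pp. 240–241 (fixed-lattice counts).
* [Rogawski1990] J. D. Rogawski, *Automorphic Representations of Unitary Groups in Three Variables*, Ann. of Math. Stud. 123 (1990): §4.9 Prop. 4.9.1 (b) p. 55.
-/

set_option autoImplicit false

noncomputable section

namespace Summit.HodgeConjecture.HodgeConjecture.Cruxes.H413.F0P3cDyRamDiagonalCellDigitMap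

open scoped Valued WithZero
open WithZero
open Literature.NumberTheory.Automorphic.UnitaryThreeFourFrame (IsRamifiedQuadraticDatum normSign)
open Literature.NumberTheory.LocalFields.WildQuadraticDatum (normSign_eq_of_near normSign_mul_eq_of_fixed_of_v_sub_one_le)
open Summit.HodgeConjecture.HodgeConjecture.Cruxes.H413.F0P3cDyRamToricCensusDefs
open Summit.HodgeConjecture.HodgeConjecture.Cruxes.H413.F0P3cDyRamDiagonalCellLiteralDigits (hatw_add_map_hatw)
open Summit.HodgeConjecture.HodgeConjecture.Cruxes.H413.F0P3cDyRamDiagonalCellFibreTransport (hatw_div_hatw_eq_one_add)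
open Summit.HodgeConjecture.HodgeConjecture.Cruxes.H413.F0P3cDyRamDiagonalCellGeneratorIndependence (coords_letters_of_gen)

variable {K : Type} [Field K] [Valued K ℤᵐ⁰] {ρ Θ : K →+* K} {α : K}

/-! ## §1 The literal is constant on digit classes -/

/-- **THE LITERAL IS CONSTANT ON DIGIT CLASSES** (one field `K = M` with the ramified datum for `Θ`, complete): for doubly fixed integers `Y, Y′` with `|Y′ − Y| ≤ |ϖ|^{2d}` and any
`c`, `ω_Θ(ŵ(Y′)∕c) = ω_Θ(ŵ(Y)∕c)`, `ŵ(Y) = (Y − ρθ₀)∕(θ₀ − ρθ₀)` — since `ŵ(Y′)∕ŵ(Y) = 1 + (Y′ − Y)∕(Y − ρθ₀)` is a `Θ`-fixed unit `≡ 1 (ϖ^{2d})`, a `Θ`-norm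
(★ `normSign_mul_eq_of_fixed_of_v_sub_one_le`, `2d ≥ 2d − 1`). [cite: Serre1979, Ch. V §3 Cor. 3; Ch. XV §2] -/
theorem normSign_hatw_div_eq_of_near [CompleteSpace K] (hρρ : ∀ x, ρ (ρ x) = x) (hvρ : ∀ x, Valued.v (ρ x) = Valued.v x) (hΘρ : ∀ x, Θ (ρ x) = ρ (Θ x))
    {ϖ : K} {d t : ℕ} (hD : IsRamifiedQuadraticDatum Θ ϖ d t) {θ₀ : K} (hΘθ₀ : Θ θ₀ = θ₀) (hθ1 : Valued.v θ₀ ≤ 1) (hθρ : Valued.v (θ₀ - ρ θ₀) = 1) (c : K)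
    {Y Y' : K} (hρY : ρ Y = Y) (hΘY : Θ Y = Y) (hY1 : Valued.v Y ≤ 1) (hΘY' : Θ Y' = Y') (hnear : Valued.v (Y' - Y) ≤ Valued.v ϖ ^ (2 * d)) :
    normSign Θ ((Y' - ρ θ₀) / (θ₀ - ρ θ₀) / c) = normSign Θ ((Y - ρ θ₀) / (θ₀ - ρ θ₀) / c) := by
  have hθ₀ : ρ θ₀ ≠ θ₀ := fun h0 => by rw [h0, sub_self, map_zero] at hθρ; exact zero_ne_one hθρ
  have hδ : θ₀ - ρ θ₀ ≠ 0 := sub_ne_zero.2 (Ne.symm hθ₀)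
  -- `ŵ(Y)` is a unit (its `ρ`-trace is `1`), so `|Y − ρθ₀| = 1`
  have hle : Valued.v ((Y - ρ θ₀) / (θ₀ - ρ θ₀)) ≤ 1 := by
    rw [map_div₀, hθρ, div_one]; exact (Valuation.map_sub _ _ _).trans (max_le hY1 (by rw [hvρ]; exact hθ1))
  have hunit : Valued.v ((Y - ρ θ₀) / (θ₀ - ρ θ₀)) = 1 := by
    by_contra hne
    have hlt : Valued.v ((Y - ρ θ₀) / (θ₀ - ρ θ₀)) < 1 := lt_of_le_of_ne hle hne
    have h1 : Valued.v ((Y - ρ θ₀) / (θ₀ - ρ θ₀) + ρ ((Y - ρ θ₀) / (θ₀ - ρ θ₀))) < 1 :=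
      lt_of_le_of_lt (Valuation.map_add _ _ _) (max_lt hlt (by rw [hvρ]; exact hlt))
    rw [hatw_add_map_hatw (θ₀ := θ₀) hρρ hθ₀ hρY, Valuation.map_one] at h1
    exact lt_irrefl _ h1
  have hYθ1 : Valued.v (Y - ρ θ₀) = 1 := by rw [map_div₀, hθρ, div_one] at hunit; exact hunit
  have hYθ : Y - ρ θ₀ ≠ 0 := fun h0 => by rw [h0, map_zero] at hYθ1; exact zero_ne_one hYθ1
  have hŵ0 : (Y - ρ θ₀) / (θ₀ - ρ θ₀) ≠ 0 := div_ne_zero hYθ hδ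
  -- the ratio `u = 1 + (Y′ − Y)∕(Y − ρθ₀)`
  set u : K := 1 + (Y' - Y) / (Y - ρ θ₀) with hu
  have hΘu : Θ u = u := by rw [hu, map_add, map_one, map_div₀, map_sub, map_sub, hΘY', hΘY, hΘρ, hΘθ₀]
  have hu1 : Valued.v (u - 1) ≤ Valued.v ϖ ^ (2 * d) := by rw [hu, add_sub_cancel_left, map_div₀, hYθ1, div_one]; exact hnear
  have e : (Y' - ρ θ₀) / (θ₀ - ρ θ₀) / c = (Y - ρ θ₀) / (θ₀ - ρ θ₀) / c * u := by
    rw [hu, ← hatw_div_hatw_eq_one_add (ρ := ρ) hYθ hδ]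
    field_simp
  rw [e]
  exact normSign_mul_eq_of_fixed_of_v_sub_one_le hD _ hΘu (n := 2 * d) (by omega) hu1

/-! ## §2 Every lattice of the diagonal cell has a literal digit -/

/-- **`ŵ(V(x₀))∕ŵ(x_ref)` IS A `Θ`-NORM.**  One-field RamK letters (`ρ`, `Θ`, `α`, `h`, `ϖE`, pivot `θ₀`, `1 ≤ b`), the letter `hFN` («doubly fixed units are `Θ`-norms»), a generator
`x₀` with the Gram-primitivity and level clauses of `levelSet ρ Θ α ϖE h b b`, and any `x_ref ≠ 0`: with `ŵ(x) = (ν·h·xΘx)⁻¹`, `V(x₀) = Tr_ρ(θ₀ŵ(x₀))∕Tr_ρ ŵ(x₀)`,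
`ŵ(V) = (V − ρθ₀)∕(θ₀ − ρθ₀)`, there is `z` with `zΘz = ŵ(V(x₀))∕ŵ(x_ref)` — since `ŵ(x₀) = T·ŵ(V)` (★ K5c), `T = z_TΘz_T` (`hFN`) and `ŵ(x₀)∕ŵ(x_ref) = N_Θ(x_ref∕x₀)`.
[cite: Jacobowitz1962, §4] [cite: Rogawski1990, §4.9 Prop. 4.9.1 (b) p. 55] -/
theorem exists_mul_map_eq_hatwV_div (hρρ : ∀ x, ρ (ρ x) = x) (hvρ : ∀ x, Valued.v (ρ x) = Valued.v x) (hΘΘ : ∀ x, Θ (Θ x) = x)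
    (hΘρ : ∀ x, Θ (ρ x) = ρ (Θ x)) (hvΘ : ∀ x, Valued.v (Θ x) = Valued.v x) (hαρ1 : Valued.v (α - ρ α) = 1) (hram : Valued.v (α - Θ α) < 1)
    {h ϖE θ₀ : K} (hΘh : Θ h = h) (hρϖ : ρ ϖE = ϖE) (hϖE : Valued.v ϖE = exp (-1 : ℤ))
    (hΘθ₀ : Θ θ₀ = θ₀) (hθ1 : Valued.v θ₀ ≤ 1) (hθρ : Valued.v (θ₀ - ρ θ₀) = 1) {b : ℕ} (hb1 : 1 ≤ b)
    (hFN : ∀ f : K, ρ f = f → Θ f = f → Valued.v f = 1 → ∃ z : K, z * Θ z = f)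
    {x₀ xr : K} (hx₀ : x₀ ≠ 0) (hxr : xr ≠ 0)
    (hprim : ¬ IsOrd ρ α (ϖE ^ b) (dualGen ρ Θ α (ϖE ^ b) h x₀ / ϖE)) (hlev : Valued.v (dualGen ρ Θ α (ϖE ^ b) h x₀) = Valued.v ϖE ^ b) :
    ∃ z : K, z * Θ z =
      ((θ₀ * (((α - ρ α) * Θ (α - ρ α)) * (h * (x₀ * Θ x₀)))⁻¹ + ρ (θ₀ * (((α - ρ α) * Θ (α - ρ α)) * (h * (x₀ * Θ x₀)))⁻¹)) /
            ((((α - ρ α) * Θ (α - ρ α)) * (h * (x₀ * Θ x₀)))⁻¹ + ρ (((α - ρ α) * Θ (α - ρ α)) * (h * (x₀ * Θ x₀)))⁻¹) - ρ θ₀) / (θ₀ - ρ θ₀) /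
        (((α - ρ α) * Θ (α - ρ α)) * (h * (xr * Θ xr)))⁻¹ := by
  obtain ⟨hκv, hŵv, -, hTv, hρT, hΘT, -, -, -, hfact⟩ :=
    coords_letters_of_gen hρρ hvρ hΘΘ hΘρ hvΘ hαρ1 hram hΘh hρϖ hϖE hΘθ₀ hθ1 hθρ hb1 hprim hlev
  set ν : K := (α - ρ α) * Θ (α - ρ α) with hν
  set κ : K := h * (x₀ * Θ x₀) with hκ
  set ŵ : K := (ν * κ)⁻¹ with hŵdef
  set T : K := ŵ + ρ ŵ with hTdef
  set W : K := θ₀ * ŵ + ρ (θ₀ * ŵ) with hWdef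
  set V : K := W / T with hVdef
  have hT0 : T ≠ 0 := fun h0 => by rw [h0, map_zero] at hTv; exact zero_ne_one hTv
  have hνv : Valued.v ν = 1 := by rw [hν, Valuation.map_mul, hvΘ, hαρ1, mul_one]
  have hν0 : ν ≠ 0 := fun h0 => by rw [h0, map_zero] at hνv; exact zero_ne_one hνv
  have hκ0 : κ ≠ 0 := fun h0 => by rw [h0, map_zero] at hκv; exact zero_ne_one hκv
  have hh0 : h ≠ 0 := fun h0 => hκ0 (by rw [hκ, h0, zero_mul])
  have hΘx₀ : Θ x₀ ≠ 0 := (map_ne_zero Θ).2 hx₀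
  have hΘxr : Θ xr ≠ 0 := (map_ne_zero Θ).2 hxr
  obtain ⟨zT, hzT⟩ := hFN T hρT hΘT hTv
  have hzT0 : zT ≠ 0 := fun h0 => hT0 (by rw [← hzT, h0, zero_mul])
  have hΘzT : Θ zT ≠ 0 := (map_ne_zero Θ).2 hzT0
  -- `ŵ(V) = ŵ∕T`
  have hŵV : (V - ρ θ₀) / (θ₀ - ρ θ₀) = ŵ / T := by rw [eq_div_iff hT0, mul_comm, ← hfact]
  refine ⟨xr / x₀ / zT, ?_⟩
  rw [hŵV, hŵdef, ← hzT, map_div₀, map_div₀, hκ]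
  field_simp

/-! ## §3 The affine label is constant on digit classes -/

/-- **THE AFFINE LABEL IS CONSTANT ON DIGIT CLASSES** (one field `K = E` with the ramified datum for `σ`, complete): `σ`-fixed `α₁, γ₁` with `|α₁| = 1`, `|γ₁| < 1`, `σ`-fixed
integers `V, V′` with `|V′ − V| ≤ |ϖ|^{2d}` ⇒ `ω_σ(α₁ + γ₁V′) = ω_σ(α₁ + γ₁V)` (★ `normSign_eq_of_near` at depth `2d ≥ 2d − 1`). [cite: Serre1979, Ch. XV §2] -/
theorem normSign_affineLabel_eq_of_near [CompleteSpace K] {σ : K →+* K} {ϖ : K} {d t : ℕ} (hD : IsRamifiedQuadraticDatum σ ϖ d t)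
    {α₁ γ₁ : K} (hσα : σ α₁ = α₁) (hα1 : Valued.v α₁ = 1) (hσγ : σ γ₁ = γ₁) (hγ1 : Valued.v γ₁ < 1)
    {V V' : K} (hσV : σ V = V) (hV1 : Valued.v V ≤ 1) (hσV' : σ V' = V') (hnear : Valued.v (V' - V) ≤ Valued.v ϖ ^ (2 * d)) :
    normSign σ (α₁ + γ₁ * V') = normSign σ (α₁ + γ₁ * V) := by
  have hg : Valued.v (α₁ + γ₁ * V) = 1 := by
    have hlt : Valued.v (γ₁ * V) < Valued.v α₁ := by
      rw [hα1, Valuation.map_mul]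
      calc Valued.v γ₁ * Valued.v V ≤ Valued.v γ₁ * 1 := by gcongr
        _ < 1 := by rw [mul_one]; exact hγ1
    rw [Valuation.map_add_eq_of_lt_left _ hlt, hα1]
  refine normSign_eq_of_near hD (by rw [map_add, map_mul, hσα, hσγ, hσV]) (by rw [map_add, map_mul, hσα, hσγ, hσV']) hg (n := 2 * d) (by omega) ?_
  have e : α₁ + γ₁ * V - (α₁ + γ₁ * V') = -(γ₁ * (V' - V)) := by ring
  rw [e, Valuation.map_neg, Valuation.map_mul]
  calc Valued.v γ₁ * Valued.v (V' - V) ≤ 1 * Valued.v ϖ ^ (2 * d) := by gcongr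
    _ = _ := one_mul _

/-! ## §4 An `E`-side preimage of a doubly fixed integer -/

/-- **A DOUBLY FIXED INTEGER OF `M` COMES FROM `E`**: `jE : E → M` with image `Fix ρ` and `Θ ∘ jE = jE ∘ σ`, isometric; a `ρ`-fixed, `Θ`-fixed `Y` with `|Y| ≤ 1` is `jE V` with
`σV = V`, `|V| ≤ 1`. [cite: Serre1979, Ch. V §2 Prop. 3] -/
theorem exists_preimage_of_fixed {E : Type} [Field E] [Valued E ℤᵐ⁰] {σ : E →+* E} (jE : E →+* K)
    (hjiso : ∀ a, Valued.v (jE a) = Valued.v a) (hjfix : ∀ z : K, ρ z = z ↔ ∃ a, jE a = z) (hΘj : ∀ a, Θ (jE a) = jE (σ a))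
    {Y : K} (hρY : ρ Y = Y) (hΘY : Θ Y = Y) (hY1 : Valued.v Y ≤ 1) : ∃ V : E, jE V = Y ∧ σ V = V ∧ Valued.v V ≤ 1 := by
  obtain ⟨V, rfl⟩ := (hjfix Y).1 hρY
  exact ⟨V, rfl, jE.injective (by rw [← hΘj, hΘY]), by rw [← hjiso]; exact hY1⟩

end Summit.HodgeConjecture.HodgeConjecture.Cruxes.H413.F0P3cDyRamDiagonalCellDigitMap

end
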